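import Mathlib
import HarnessLib
import Summits.QuantumFields.YangMills.Theorems.ComplexCouplingChannelContinuumLegGivenGapPtuAssemblyFar

/-!
# `ContinuumLegGivenGap` (stmt-QuantumFields-15828), line `alternating-curvature-arrays`: `stub_ptuAssembly`, the FAR pieces — the two scale regimes and the sum over one level

Support file for `stub_ptuAssembly`, continuing `…PtuAssemblyFar` (`ptuFar_core`).  The `ℓ`-bookkeeping of one far
piece in the two regimes (`ℓ = a_k · cellSide m`):
* `ptuFarSum_piece_small` (`ℓ ≤ 1`; flat order `p p₀ + p t + p(s+6)`, decay `6p`): `‖piece‖ ≤ Θ ℓ^{4p+1} ((1+‖g‖)⁶)⁻ᵖ |F|`;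
* `ptuFarSum_piece_large` (`ℓ > 1`; flat order `0`, decay `6p + p(p₀+s) + 2p`): `‖piece‖ ≤ Θ ℓ⁻¹ ((1+‖g‖)⁶)⁻ᵖ |F|`;
with `Θ = X₀^p c' (2A₈)^{pt} 2^{6p+(p(p₀+s)+2p)+1} 240^{p p₀+p t+p(s+6)}` and the Schwartz index `p (2t + p₀ + s + 12)`; then
* `ptuFarSum_theta_shape` — `Θ (2p+1)^4 c₁^p ≤ Ω₁^{p+1} (p+1)^{(s+16t+4)(p+1)}` with an explicit `Ω₁`;
* `ptuFarSum_level_le` (registered anchor) — the SUM OVER ONE LEVEL: with the counting bound of piece 1 (box points `g`),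
  `∑_{(v,z) ∈ ptuIdx} ‖piece‖ ≤ Ω₁^{p+1} (p+1)^{(s+16t+4)(p+1)} · min(ℓ, ℓ⁻¹) · |F|_{p(2t+p₀+s+12)}`.
No definitions. [folklore]
-/

set_option autoImplicit false

noncomputable section

open scoped Classical

namespace Summit.QuantumFields.YangMills.Theorems.ContinuumLegGivenGap

open scoped SchwartzMap BigOperators ContDiff
open MeasureTheory Filter Topology
open Literature.MathematicalPhysics.QuantumFieldTheory Literature.MathematicalPhysics.QuantumLattice
  Literature.MathematicalPhysics.AQFT
open Literature.Probability.LatticeModels (box Site)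
open Summit.QuantumFields.YangMills.Cruxes.ContinuumLimitOnTrajectory.TwoOrbitSynchronisation
  (PlaqIdx plaq canonDistribution)
open Summit.QuantumFields.YangMills.Theorems.ContinuumLimitExists.Negative (centredMoment)
open Summit.QuantumFields.YangMills.Theorems.ContinuumLegGivenGap.AlternatingArrays (cellSide cellNorm physCore)

/-- The Schwartz index of the small regime (registered anchor of this file): flat order `p p₀ + p t + p(s+6)` and decay
`6p` on top of the engine's `p t` add up to `p (2t + p₀ + s + 12)`. [folklore] -/
theorem ptuFarSum_index_small : ∀ (p t p₀ s : ℕ),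
    p * t + (p * p₀ + p * t + p * (s + 6)) + (6 * p + 0) = p * (2 * t + p₀ + s + 12) := by
  intro p t p₀ s; ring

section Piece

variable {G : Type} [Group G] [TopologicalSpace G] [IsTopologicalGroup G] [CompactSpace G]
  [MeasurableSpace G] [BorelSpace G]

set_option maxHeartbeats 1000000 in
/-- **Small scales** (`ℓ ≤ 1`): flat order `p p₀ + p t + p(s+6)` and decay `6p` in `ptuFar_core`; flatness pays the
`ℓ^{-p p₀}` of the engine and the `ℓ^{-p t}` of the weight, leaving `ℓ^{p(s+6)} ≤ ℓ^{4p+1}`. [folklore] -/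
theorem ptuFarSum_piece_small (r : LatticeRep G) (sch : SpeciesScheme (YMSpecies G)) (k p : ℕ)
    (q : Fin p → PlaqIdx) (F : 𝓢((Fin p → EuclideanSpace ℝ (Fin 4)), ℂ)) (hF : IsOffDiagonal F) (m : ℕ) (v : Fin 4 → ℤ)
    (z : Fin p → Fin 4 → ℤ) {C K c₂ : ℝ} {p₀ s t : ℕ} (hC : 0 ≤ C) (hK : 0 ≤ K) (hc₂ : 0 < c₂) (hp : 1 ≤ p)
    (hLB : (∀ (G' : Type) [Group G'] [TopologicalSpace G'] [IsTopologicalGroup G'] [CompactSpace G'] [MeasurableSpace G']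
      [BorelSpace G'] (r : LatticeRep G') (sch : SpeciesScheme (YMSpecies G')) (k p : ℕ) (q : Fin p → PlaqIdx) (m : ℕ)
      (v : Fin 4 → ℤ) (z : Fin p → Fin 4 → ℤ) (C M : ℝ) (p₀ : ℕ) (χ : Fin p → 𝓢(EuclideanSpace ℝ (Fin 4), ℝ)),
      0 ≤ C → 0 ≤ M →
      (∀ (f : Fin p → 𝓢(EuclideanSpace ℝ (Fin 4), ℝ)) (F : 𝓢((Fin p → EuclideanSpace ℝ (Fin 4)), ℂ)),
        (∀ i, tsupport (f i) ⊆ physCore (sch.a k) m v (z i)) → IsTensorOf F (fun i => ofRealTest (f i)) →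
        ‖canonDistribution r sch k p (fun i => plaq r (q i)) F‖ ≤
          ∏ i, C * max (sch.a k * cellSide m) (sch.a k * cellSide m)⁻¹ ^ p₀ *
            cellNorm s (sch.a k * cellSide m) (f i)) →
      (∀ i, tsupport (χ i) ⊆ physCore (sch.a k) m v (z i)) →
      (∀ i, ∀ j ≤ s, ∀ y, (sch.a k * cellSide m) ^ j * ‖iteratedFDeriv ℝ j (χ i) y‖ ≤ M) →
      ∀ Gf : 𝓢((Fin p → EuclideanSpace ℝ (Fin 4)), ℂ),
        ‖∑ x : Fin p → ↥(box 4 (sch.L k)), (∏ i, ((χ i (sch.a k • siteToE (↑(x i) : Site 4)) : ℝ) : ℂ)) *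
            Gf (fun i => sch.a k • siteToE (↑(x i) : Site 4)) *
            ((centredMoment r (sch.L k) (sch.β k) p (fun i => some (q i)) (fun i => (x i : Site 4)) : ℝ) : ℂ)‖ ≤
          (2 * C * max (sch.a k * cellSide m) (sch.a k * cellSide m)⁻¹ ^ p₀ *
              ((s + 1) * 2 ^ s * M * max 1 (sch.a k * cellSide m) ^ s) * K) ^ p * schwartzNorm (p * t) Gf))
    (hFlat : (∀ (p n M K : ℕ) (F : 𝓢((Fin p → EuclideanSpace ℝ (Fin 4)), ℂ)), IsOffDiagonal F →
        ∀ (w : (Fin p → EuclideanSpace ℝ (Fin 4)) → ℝ) (A D δ d : ℝ), ContDiff ℝ ∞ w → HasCompactSupport w →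
          0 ≤ A → 0 ≤ D → 0 ≤ δ → 0 ≤ d →
          (∀ i ≤ n, ∀ y : (Fin p → EuclideanSpace ℝ (Fin 4)), ‖iteratedFDeriv ℝ i w y‖ ≤ A * D ^ i) →
          (∀ y ∈ tsupport w, ∃ i j : Fin p, i ≠ j ∧ ‖y i - y j‖ ≤ δ) →
          (∀ y ∈ tsupport w, d ≤ ‖y‖) →
          schwartzNorm n (SchwartzMap.smulLeftCLM ℂ (fun y : (Fin p → EuclideanSpace ℝ (Fin 4)) => ((w y : ℝ) : ℂ)) F) ≤
            A * (2 * max 1 D) ^ n * 2 ^ (K + 1) * δ ^ M * ((1 + d) ^ K)⁻¹ * schwartzNorm (n + M + K) F))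
    (hPB : ∀ (f : Fin p → 𝓢(EuclideanSpace ℝ (Fin 4), ℝ)) (F' : 𝓢((Fin p → EuclideanSpace ℝ (Fin 4)), ℂ)),
      (∀ i, tsupport (f i) ⊆ physCore (sch.a k) m v (z i)) → IsTensorOf F' (fun i => ofRealTest (f i)) →
      ‖canonDistribution r sch k p (fun i => plaq r (q i)) F'‖ ≤
        ∏ i, C * max (sch.a k * cellSide m) (sch.a k * cellSide m)⁻¹ ^ p₀ * cellNorm s (sch.a k * cellSide m) (f i))
    (hχsupp : ∀ i : Fin p, tsupport (ptuChiFun (sch.a k) m p v (z i)) ⊆ physCore (sch.a k) m v (z i))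
    (hχbd : ∀ (i : Fin p) (j : ℕ) (u : EuclideanSpace ℝ (Fin 4)),
      (sch.a k * cellSide m) ^ j * ‖iteratedFDeriv ℝ j (ptuChiFun (sch.a k) m p v (z i)) u‖ ≤
        c₂ * (c₂ * ((p : ℝ) + 1) * ((j : ℝ) + 1) ^ 4) ^ j)
    (hwC : ContDiff ℝ ∞ (ptuWeight (sch.a k) (sch.L k) p m v z))
    (hwK : HasCompactSupport (ptuWeight (sch.a k) (sch.L k) p m v z))
    (hwsupp : tsupport (ptuWeight (sch.a k) (sch.L k) p m v z) ⊆ tsupport (ptuPhiTilde (sch.a k) m p v z))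
    (hwbd : ∀ (n : ℕ) (y : (Fin p → EuclideanSpace ℝ (Fin 4))), ‖iteratedFDeriv ℝ n (ptuWeight (sch.a k) (sch.L k) p m v z) y‖ ≤
      c₂ * (c₂ * ((p : ℝ) + 1) ^ 8 * ((n : ℝ) + 1) ^ 8 / (sch.a k * cellSide m)) ^ n)
    (hgeo : ∀ y : (Fin p → EuclideanSpace ℝ (Fin 4)), y ∈ tsupport (ptuPhiTilde (sch.a k) m p v z) →
      (∃ i j : Fin p, i ≠ j ∧ ‖y i - y j‖ ≤ 240 * (sch.a k * cellSide m)) ∧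
      ∀ (i : Fin p) (μ : Fin 4), sch.a k * ((v μ : ℝ) + cellSide m * (z i μ : ℝ)) ≤ y i μ ∧
        y i μ ≤ sch.a k * ((v μ : ℝ) + cellSide m * ((z i μ : ℝ) + 1)))
    (hsep : ∃ i j : Fin p, i ≠ j ∧ (16 : ℝ) ≤ ‖z i - z j‖)
    (hℓ1 : sch.a k * cellSide m ≤ 1) :
    ‖∑ x : Fin p → ↥(box 4 (sch.L k)),
        (∏ i, ((ptuChi (sch.a k) m p v (z i) (sch.a k • siteToE (↑(x i) : Site 4)) : ℝ) : ℂ)) *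
          (SchwartzMap.smulLeftCLM ℂ
              (fun y : (Fin p → EuclideanSpace ℝ (Fin 4)) => ((ptuWeight (sch.a k) (sch.L k) p m v z y : ℝ) : ℂ)) F)
            (fun i => sch.a k • siteToE (↑(x i) : Site 4)) *
          ((centredMoment r (sch.L k) (sch.β k) p (fun i => some (q i)) (fun i => (x i : Site 4)) : ℝ) : ℂ)‖ ≤
      ((2 * C * K * (((s : ℝ) + 1) * 2 ^ s * (max c₂ 1 * (max c₂ 1 * ((p : ℝ) + 1) * ((s : ℝ) + 1) ^ 4) ^ s))) ^ p * max c₂ 1 * (2 * (max c₂ 1 * ((p : ℝ) + 1) ^ 8 * ((p : ℝ) * t + 1) ^ 8)) ^ (p * t) * 2 ^ (6 * p + (p * (p₀ + s) + 2 * p) + 1) * (240 : ℝ) ^ (p * p₀ + p * t + p * (s + 6))) *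
        (sch.a k * cellSide m) ^ (4 * p + 1) * (((1 + ‖(fun i : Fin p => (WithLp.toLp 2 (fun μ : Fin 4 => max (sch.a k * ((v μ : ℝ) + cellSide m * (z i μ : ℝ))) (min 0 (sch.a k * ((v μ : ℝ) + cellSide m * ((z i μ : ℝ) + 1))))) : EuclideanSpace ℝ (Fin 4)))‖) ^ 6)⁻¹) ^ p * schwartzNorm (p * (2 * t + p₀ + s + 12)) F := by
  have hcore := ptuFar_core r sch k p q F hF m v z hC hK hc₂ hp hLB hFlat hPB hχsupp hχbd hwC hwK hwsupp hwbd hgeo hsep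
    (p * p₀ + p * t + p * (s + 6)) 0
  set ℓ : ℝ := sch.a k * cellSide m with hℓdef
  have hℓ : 0 < ℓ := ptuKit_ell_pos (sch.a_pos k) m
  have hc1 : 1 ≤ max c₂ 1 := le_max_right _ _
  have hp1 : (1 : ℝ) ≤ (p : ℝ) + 1 := by linarith [(Nat.cast_nonneg p : (0 : ℝ) ≤ p)]
  have hA1 : 1 ≤ (max c₂ 1 * ((p : ℝ) + 1) ^ 8 * ((p : ℝ) * t + 1) ^ 8) := by
    have h2 : (1 : ℝ) ≤ ((p : ℝ) + 1) ^ 8 := one_le_pow₀ hp1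
    have h3 : (1 : ℝ) ≤ ((p : ℝ) * t + 1) ^ 8 :=
      one_le_pow₀ (by nlinarith [(Nat.cast_nonneg p : (0 : ℝ) ≤ p), (Nat.cast_nonneg t : (0 : ℝ) ≤ t)])
    calc (1 : ℝ) = 1 * 1 * 1 := by ring
      _ ≤ _ := by gcongr
  -- the three `max` of the core in the small regime
  have hmax1 : max ℓ ℓ⁻¹ = ℓ⁻¹ := max_eq_right (hℓ1.trans (one_le_inv_iff₀.2 ⟨hℓ, hℓ1⟩))
  have hmax2 : max 1 ℓ = 1 := max_eq_left hℓ1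
  have hmax3 : max 1 ((max c₂ 1 * ((p : ℝ) + 1) ^ 8 * ((p : ℝ) * t + 1) ^ 8) / ℓ) = (max c₂ 1 * ((p : ℝ) + 1) ^ 8 * ((p : ℝ) * t + 1) ^ 8) / ℓ :=
    max_eq_right ((one_le_div hℓ).2 (hℓ1.trans hA1))
  rw [hmax1, hmax2, hmax3] at hcore
  refine hcore.trans ?_
  -- Schwartz index
  have hidx : p * t + (p * p₀ + p * t + p * (s + 6)) + (6 * p + 0) = (p * (2 * t + p₀ + s + 12)) :=
    ptuFarSum_index_small p t p₀ s
  rw [hidx]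
  -- the decay factor
  set bp := (fun i : Fin p => (WithLp.toLp 2 (fun μ : Fin 4 => max (sch.a k * ((v μ : ℝ) + cellSide m * (z i μ : ℝ))) (min 0 (sch.a k * ((v μ : ℝ) + cellSide m * ((z i μ : ℝ) + 1))))) : EuclideanSpace ℝ (Fin 4))) with hbp
  have hbp0 : 0 ≤ ‖bp‖ := norm_nonneg _
  have hinv : ((1 + max ‖bp‖ (7 * ℓ)) ^ (6 * p + 0))⁻¹ ≤ (((1 + ‖bp‖) ^ 6)⁻¹) ^ p := by
    rw [add_zero, inv_pow, ← pow_mul]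
    refine inv_anti₀ (by positivity) (pow_le_pow_left₀ (by positivity) ?_ _)
    linarith [le_max_left ‖bp‖ (7 * ℓ)]
  -- the `ℓ`-bookkeeping (opaque atoms for `ring`)
  set Mc : ℝ := (max c₂ 1 * (max c₂ 1 * ((p : ℝ) + 1) * ((s : ℝ) + 1) ^ 4) ^ s) with hMc
  set A : ℝ := (max c₂ 1 * ((p : ℝ) + 1) ^ 8 * ((p : ℝ) * t + 1) ^ 8) with hA
  set s1 : ℝ := (s : ℝ) + 1 with hs1
  have key : (2 * C * ℓ⁻¹ ^ p₀ * (s1 * 2 ^ s * Mc * 1 ^ s) * K) ^ p *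
      (max c₂ 1 * (2 * (A / ℓ)) ^ (p * t) * 2 ^ ((6 * p + 0) + 1) *
        (240 * ℓ) ^ (p * p₀ + p * t + p * (s + 6))) =
      ((2 * C * K * (s1 * 2 ^ s * Mc)) ^ p * max c₂ 1 * (2 * A) ^ (p * t) * 2 ^ (6 * p + 1) *
          (240 : ℝ) ^ (p * p₀ + p * t + p * (s + 6))) *
        (ℓ⁻¹ ^ (p₀ * p) * ℓ⁻¹ ^ (p * t) * ℓ ^ (p * p₀ + p * t + p * (s + 6))) := by
    rw [add_zero, one_pow, mul_one]
    ring
  have hℓpow : ℓ⁻¹ ^ (p₀ * p) * ℓ⁻¹ ^ (p * t) * ℓ ^ (p * p₀ + p * t + p * (s + 6)) = ℓ ^ (p * (s + 6)) := by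
    rw [pow_add, pow_add, inv_pow, inv_pow, mul_comm p₀ p]
    field_simp
  have hℓle : ℓ ^ (p * (s + 6)) ≤ ℓ ^ (4 * p + 1) :=
    pow_le_pow_of_le_one hℓ.le hℓ1 (by nlinarith)
  have hconst : (2 * C * K * (s1 * 2 ^ s * Mc)) ^ p * max c₂ 1 * (2 * A) ^ (p * t) * 2 ^ (6 * p + 1) *
      (240 : ℝ) ^ (p * p₀ + p * t + p * (s + 6)) ≤ ((2 * C * K * (s1 * 2 ^ s * Mc)) ^ p * max c₂ 1 * (2 * A) ^ (p * t) * 2 ^ (6 * p + (p * (p₀ + s) + 2 * p) + 1) * (240 : ℝ) ^ (p * p₀ + p * t + p * (s + 6))) := by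
    have h2 : (2 : ℝ) ^ (6 * p + 1) ≤ 2 ^ (6 * p + (p * (p₀ + s) + 2 * p) + 1) :=
      pow_le_pow_right₀ one_le_two (by omega)
    have hX : 0 ≤ (2 * C * K * (s1 * 2 ^ s * Mc)) := by positivity
    gcongr
  have hsN : 0 ≤ schwartzNorm (p * (2 * t + p₀ + s + 12)) F := schwartzNorm_nonneg _ _
  have hΘ0 : 0 ≤ ((2 * C * K * (s1 * 2 ^ s * Mc)) ^ p * max c₂ 1 * (2 * A) ^ (p * t) * 2 ^ (6 * p + (p * (p₀ + s) + 2 * p) + 1) * (240 : ℝ) ^ (p * p₀ + p * t + p * (s + 6))) := by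
    have := zero_le_one.trans hA1
    positivity
  calc (2 * C * ℓ⁻¹ ^ p₀ * (s1 * 2 ^ s * Mc * 1 ^ s) * K) ^ p *
        (max c₂ 1 * (2 * (A / ℓ)) ^ (p * t) * 2 ^ ((6 * p + 0) + 1) *
          (240 * ℓ) ^ (p * p₀ + p * t + p * (s + 6)) *
          ((1 + max ‖bp‖ (7 * ℓ)) ^ (6 * p + 0))⁻¹ * schwartzNorm (p * (2 * t + p₀ + s + 12)) F)
      = ((2 * C * ℓ⁻¹ ^ p₀ * (s1 * 2 ^ s * Mc * 1 ^ s) * K) ^ p *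
          (max c₂ 1 * (2 * (A / ℓ)) ^ (p * t) * 2 ^ ((6 * p + 0) + 1) *
            (240 * ℓ) ^ (p * p₀ + p * t + p * (s + 6)))) *
          ((1 + max ‖bp‖ (7 * ℓ)) ^ (6 * p + 0))⁻¹ * schwartzNorm (p * (2 * t + p₀ + s + 12)) F := by ring
    _ = ((2 * C * K * (s1 * 2 ^ s * Mc)) ^ p * max c₂ 1 * (2 * A) ^ (p * t) * 2 ^ (6 * p + 1) *
          (240 : ℝ) ^ (p * p₀ + p * t + p * (s + 6))) * ℓ ^ (p * (s + 6)) *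
          ((1 + max ‖bp‖ (7 * ℓ)) ^ (6 * p + 0))⁻¹ * schwartzNorm (p * (2 * t + p₀ + s + 12)) F := by rw [key, hℓpow]
    _ ≤ ((2 * C * K * (s1 * 2 ^ s * Mc)) ^ p * max c₂ 1 * (2 * A) ^ (p * t) * 2 ^ (6 * p + (p * (p₀ + s) + 2 * p) + 1) * (240 : ℝ) ^ (p * p₀ + p * t + p * (s + 6))) * ℓ ^ (4 * p + 1) * (((1 + ‖bp‖) ^ 6)⁻¹) ^ p * schwartzNorm (p * (2 * t + p₀ + s + 12)) F := by
        gcongr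

set_option maxHeartbeats 1000000 in
/-- **Large scales** (`ℓ > 1`): flat order `0` and decay `6p + p(p₀+s) + 2p` in `ptuFar_core`; the decay
`(1+d)^{-K₂} ≤ ℓ^{-K₂}` (`d ≥ 7ℓ`) pays the `ℓ^{p p₀ + p s}` of the engine, leaving `ℓ^{-2p} ≤ ℓ⁻¹`. [folklore] -/
theorem ptuFarSum_piece_large (r : LatticeRep G) (sch : SpeciesScheme (YMSpecies G)) (k p : ℕ)
    (q : Fin p → PlaqIdx) (F : 𝓢((Fin p → EuclideanSpace ℝ (Fin 4)), ℂ)) (hF : IsOffDiagonal F) (m : ℕ) (v : Fin 4 → ℤ)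
    (z : Fin p → Fin 4 → ℤ) {C K c₂ : ℝ} {p₀ s t : ℕ} (hC : 0 ≤ C) (hK : 0 ≤ K) (hc₂ : 0 < c₂) (hp : 1 ≤ p)
    (hLB : (∀ (G' : Type) [Group G'] [TopologicalSpace G'] [IsTopologicalGroup G'] [CompactSpace G'] [MeasurableSpace G']
      [BorelSpace G'] (r : LatticeRep G') (sch : SpeciesScheme (YMSpecies G')) (k p : ℕ) (q : Fin p → PlaqIdx) (m : ℕ)
      (v : Fin 4 → ℤ) (z : Fin p → Fin 4 → ℤ) (C M : ℝ) (p₀ : ℕ) (χ : Fin p → 𝓢(EuclideanSpace ℝ (Fin 4), ℝ)),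
      0 ≤ C → 0 ≤ M →
      (∀ (f : Fin p → 𝓢(EuclideanSpace ℝ (Fin 4), ℝ)) (F : 𝓢((Fin p → EuclideanSpace ℝ (Fin 4)), ℂ)),
        (∀ i, tsupport (f i) ⊆ physCore (sch.a k) m v (z i)) → IsTensorOf F (fun i => ofRealTest (f i)) →
        ‖canonDistribution r sch k p (fun i => plaq r (q i)) F‖ ≤
          ∏ i, C * max (sch.a k * cellSide m) (sch.a k * cellSide m)⁻¹ ^ p₀ *
            cellNorm s (sch.a k * cellSide m) (f i)) →
      (∀ i, tsupport (χ i) ⊆ physCore (sch.a k) m v (z i)) →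
      (∀ i, ∀ j ≤ s, ∀ y, (sch.a k * cellSide m) ^ j * ‖iteratedFDeriv ℝ j (χ i) y‖ ≤ M) →
      ∀ Gf : 𝓢((Fin p → EuclideanSpace ℝ (Fin 4)), ℂ),
        ‖∑ x : Fin p → ↥(box 4 (sch.L k)), (∏ i, ((χ i (sch.a k • siteToE (↑(x i) : Site 4)) : ℝ) : ℂ)) *
            Gf (fun i => sch.a k • siteToE (↑(x i) : Site 4)) *
            ((centredMoment r (sch.L k) (sch.β k) p (fun i => some (q i)) (fun i => (x i : Site 4)) : ℝ) : ℂ)‖ ≤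
          (2 * C * max (sch.a k * cellSide m) (sch.a k * cellSide m)⁻¹ ^ p₀ *
              ((s + 1) * 2 ^ s * M * max 1 (sch.a k * cellSide m) ^ s) * K) ^ p * schwartzNorm (p * t) Gf))
    (hFlat : (∀ (p n M K : ℕ) (F : 𝓢((Fin p → EuclideanSpace ℝ (Fin 4)), ℂ)), IsOffDiagonal F →
        ∀ (w : (Fin p → EuclideanSpace ℝ (Fin 4)) → ℝ) (A D δ d : ℝ), ContDiff ℝ ∞ w → HasCompactSupport w →
          0 ≤ A → 0 ≤ D → 0 ≤ δ → 0 ≤ d →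
          (∀ i ≤ n, ∀ y : (Fin p → EuclideanSpace ℝ (Fin 4)), ‖iteratedFDeriv ℝ i w y‖ ≤ A * D ^ i) →
          (∀ y ∈ tsupport w, ∃ i j : Fin p, i ≠ j ∧ ‖y i - y j‖ ≤ δ) →
          (∀ y ∈ tsupport w, d ≤ ‖y‖) →
          schwartzNorm n (SchwartzMap.smulLeftCLM ℂ (fun y : (Fin p → EuclideanSpace ℝ (Fin 4)) => ((w y : ℝ) : ℂ)) F) ≤
            A * (2 * max 1 D) ^ n * 2 ^ (K + 1) * δ ^ M * ((1 + d) ^ K)⁻¹ * schwartzNorm (n + M + K) F))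
    (hPB : ∀ (f : Fin p → 𝓢(EuclideanSpace ℝ (Fin 4), ℝ)) (F' : 𝓢((Fin p → EuclideanSpace ℝ (Fin 4)), ℂ)),
      (∀ i, tsupport (f i) ⊆ physCore (sch.a k) m v (z i)) → IsTensorOf F' (fun i => ofRealTest (f i)) →
      ‖canonDistribution r sch k p (fun i => plaq r (q i)) F'‖ ≤
        ∏ i, C * max (sch.a k * cellSide m) (sch.a k * cellSide m)⁻¹ ^ p₀ * cellNorm s (sch.a k * cellSide m) (f i))
    (hχsupp : ∀ i : Fin p, tsupport (ptuChiFun (sch.a k) m p v (z i)) ⊆ physCore (sch.a k) m v (z i))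
    (hχbd : ∀ (i : Fin p) (j : ℕ) (u : EuclideanSpace ℝ (Fin 4)),
      (sch.a k * cellSide m) ^ j * ‖iteratedFDeriv ℝ j (ptuChiFun (sch.a k) m p v (z i)) u‖ ≤
        c₂ * (c₂ * ((p : ℝ) + 1) * ((j : ℝ) + 1) ^ 4) ^ j)
    (hwC : ContDiff ℝ ∞ (ptuWeight (sch.a k) (sch.L k) p m v z))
    (hwK : HasCompactSupport (ptuWeight (sch.a k) (sch.L k) p m v z))
    (hwsupp : tsupport (ptuWeight (sch.a k) (sch.L k) p m v z) ⊆ tsupport (ptuPhiTilde (sch.a k) m p v z))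
    (hwbd : ∀ (n : ℕ) (y : (Fin p → EuclideanSpace ℝ (Fin 4))), ‖iteratedFDeriv ℝ n (ptuWeight (sch.a k) (sch.L k) p m v z) y‖ ≤
      c₂ * (c₂ * ((p : ℝ) + 1) ^ 8 * ((n : ℝ) + 1) ^ 8 / (sch.a k * cellSide m)) ^ n)
    (hgeo : ∀ y : (Fin p → EuclideanSpace ℝ (Fin 4)), y ∈ tsupport (ptuPhiTilde (sch.a k) m p v z) →
      (∃ i j : Fin p, i ≠ j ∧ ‖y i - y j‖ ≤ 240 * (sch.a k * cellSide m)) ∧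
      ∀ (i : Fin p) (μ : Fin 4), sch.a k * ((v μ : ℝ) + cellSide m * (z i μ : ℝ)) ≤ y i μ ∧
        y i μ ≤ sch.a k * ((v μ : ℝ) + cellSide m * ((z i μ : ℝ) + 1)))
    (hsep : ∃ i j : Fin p, i ≠ j ∧ (16 : ℝ) ≤ ‖z i - z j‖)
    (hℓ1 : 1 < sch.a k * cellSide m) :
    ‖∑ x : Fin p → ↥(box 4 (sch.L k)),
        (∏ i, ((ptuChi (sch.a k) m p v (z i) (sch.a k • siteToE (↑(x i) : Site 4)) : ℝ) : ℂ)) *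
          (SchwartzMap.smulLeftCLM ℂ
              (fun y : (Fin p → EuclideanSpace ℝ (Fin 4)) => ((ptuWeight (sch.a k) (sch.L k) p m v z y : ℝ) : ℂ)) F)
            (fun i => sch.a k • siteToE (↑(x i) : Site 4)) *
          ((centredMoment r (sch.L k) (sch.β k) p (fun i => some (q i)) (fun i => (x i : Site 4)) : ℝ) : ℂ)‖ ≤
      ((2 * C * K * (((s : ℝ) + 1) * 2 ^ s * (max c₂ 1 * (max c₂ 1 * ((p : ℝ) + 1) * ((s : ℝ) + 1) ^ 4) ^ s))) ^ p * max c₂ 1 * (2 * (max c₂ 1 * ((p : ℝ) + 1) ^ 8 * ((p : ℝ) * t + 1) ^ 8)) ^ (p * t) * 2 ^ (6 * p + (p * (p₀ + s) + 2 * p) + 1) * (240 : ℝ) ^ (p * p₀ + p * t + p * (s + 6))) *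
        (sch.a k * cellSide m)⁻¹ * (((1 + ‖(fun i : Fin p => (WithLp.toLp 2 (fun μ : Fin 4 => max (sch.a k * ((v μ : ℝ) + cellSide m * (z i μ : ℝ))) (min 0 (sch.a k * ((v μ : ℝ) + cellSide m * ((z i μ : ℝ) + 1))))) : EuclideanSpace ℝ (Fin 4)))‖) ^ 6)⁻¹) ^ p * schwartzNorm (p * (2 * t + p₀ + s + 12)) F := by
  have hcore := ptuFar_core r sch k p q F hF m v z hC hK hc₂ hp hLB hFlat hPB hχsupp hχbd hwC hwK hwsupp hwbd hgeo hsep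
    0 (p * (p₀ + s) + 2 * p)
  set ℓ : ℝ := sch.a k * cellSide m with hℓdef
  have hℓ : 0 < ℓ := ptuKit_ell_pos (sch.a_pos k) m
  have hc1 : 1 ≤ max c₂ 1 := le_max_right _ _
  have hp1 : (1 : ℝ) ≤ (p : ℝ) + 1 := by linarith [(Nat.cast_nonneg p : (0 : ℝ) ≤ p)]
  have hA1 : 1 ≤ (max c₂ 1 * ((p : ℝ) + 1) ^ 8 * ((p : ℝ) * t + 1) ^ 8) := by
    have h2 : (1 : ℝ) ≤ ((p : ℝ) + 1) ^ 8 := one_le_pow₀ hp1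
    have h3 : (1 : ℝ) ≤ ((p : ℝ) * t + 1) ^ 8 :=
      one_le_pow₀ (by nlinarith [(Nat.cast_nonneg p : (0 : ℝ) ≤ p), (Nat.cast_nonneg t : (0 : ℝ) ≤ t)])
    calc (1 : ℝ) = 1 * 1 * 1 := by ring
      _ ≤ _ := by gcongr
  have hA0 : 0 ≤ (max c₂ 1 * ((p : ℝ) + 1) ^ 8 * ((p : ℝ) * t + 1) ^ 8) := zero_le_one.trans hA1
  have hmax1 : max ℓ ℓ⁻¹ = ℓ := max_eq_left ((inv_le_one_of_one_le₀ hℓ1.le).trans hℓ1.le)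
  have hmax2 : max 1 ℓ = ℓ := max_eq_right hℓ1.le
  have hmax3 : max 1 ((max c₂ 1 * ((p : ℝ) + 1) ^ 8 * ((p : ℝ) * t + 1) ^ 8) / ℓ) ≤ (max c₂ 1 * ((p : ℝ) + 1) ^ 8 * ((p : ℝ) * t + 1) ^ 8) :=
    max_le hA1 (div_le_self hA0 hℓ1.le)
  rw [hmax1, hmax2, pow_zero] at hcore
  refine hcore.trans ?_
  -- Schwartz index (monotone)
  have hidx : p * t + 0 + (6 * p + (p * (p₀ + s) + 2 * p)) ≤ (p * (2 * t + p₀ + s + 12)) := by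
    have : (p * (2 * t + p₀ + s + 12)) = (p * t + 0 + (6 * p + (p * (p₀ + s) + 2 * p))) + (p * t + 4 * p) := by ring
    rw [this]; exact Nat.le_add_right _ _
  have hsNle := schwartzNorm_mono hidx F
  have hsN : 0 ≤ schwartzNorm (p * (2 * t + p₀ + s + 12)) F := schwartzNorm_nonneg _ _
  -- the decay factor: `(1 + d)^{6p + K₂} ≥ ((1+‖g‖)^6)^p · ℓ^{K₂}`
  set bp := (fun i : Fin p => (WithLp.toLp 2 (fun μ : Fin 4 => max (sch.a k * ((v μ : ℝ) + cellSide m * (z i μ : ℝ))) (min 0 (sch.a k * ((v μ : ℝ) + cellSide m * ((z i μ : ℝ) + 1))))) : EuclideanSpace ℝ (Fin 4))) with hbp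
  have hbp0 : 0 ≤ ‖bp‖ := norm_nonneg _
  have hd1 : 1 + ‖bp‖ ≤ 1 + max ‖bp‖ (7 * ℓ) := by linarith [le_max_left ‖bp‖ (7 * ℓ)]
  have hd2 : ℓ ≤ 1 + max ‖bp‖ (7 * ℓ) := by linarith [le_max_right ‖bp‖ (7 * ℓ)]
  have hinv : ((1 + max ‖bp‖ (7 * ℓ)) ^ (6 * p + (p * (p₀ + s) + 2 * p)))⁻¹ ≤
      (((1 + ‖bp‖) ^ 6)⁻¹) ^ p * (ℓ ^ (p * (p₀ + s) + 2 * p))⁻¹ := by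
    rw [inv_pow, ← pow_mul, ← mul_inv, pow_add]
    refine inv_anti₀ (by positivity) (mul_le_mul (pow_le_pow_left₀ (by positivity) hd1 _)
      (pow_le_pow_left₀ hℓ.le hd2 _) (by positivity) (by positivity))
  -- the `ℓ`-bookkeeping (opaque atoms for `ring`)
  set Mc : ℝ := (max c₂ 1 * (max c₂ 1 * ((p : ℝ) + 1) * ((s : ℝ) + 1) ^ 4) ^ s) with hMc
  set A : ℝ := (max c₂ 1 * ((p : ℝ) + 1) ^ 8 * ((p : ℝ) * t + 1) ^ 8) with hA
  set s1 : ℝ := (s : ℝ) + 1 with hs1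
  have key : (2 * C * ℓ ^ p₀ * (s1 * 2 ^ s * Mc * ℓ ^ s) * K) ^ p *
      (max c₂ 1 * (2 * A) ^ (p * t) * 2 ^ ((6 * p + (p * (p₀ + s) + 2 * p)) + 1)) *
        (ℓ ^ (p * (p₀ + s) + 2 * p))⁻¹ =
      ((2 * C * K * (s1 * 2 ^ s * Mc)) ^ p * max c₂ 1 * (2 * A) ^ (p * t) * 2 ^ (6 * p + (p * (p₀ + s) + 2 * p) + 1)) *
        (ℓ ^ (p₀ * p) * ℓ ^ (s * p) * (ℓ ^ (p * (p₀ + s) + 2 * p))⁻¹) := by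
    ring
  have hℓpow : ℓ ^ (p₀ * p) * ℓ ^ (s * p) * (ℓ ^ (p * (p₀ + s) + 2 * p))⁻¹ = (ℓ ^ (2 * p))⁻¹ := by
    rw [pow_add, mul_add, pow_add, mul_comm p₀ p, mul_comm s p]
    field_simp
  have hℓle : (ℓ ^ (2 * p))⁻¹ ≤ ℓ⁻¹ := by
    refine inv_anti₀ hℓ ?_
    calc ℓ = ℓ ^ 1 := (pow_one ℓ).symm
      _ ≤ ℓ ^ (2 * p) := pow_le_pow_right₀ hℓ1.le (by omega)
  have hconst : (2 * C * K * (s1 * 2 ^ s * Mc)) ^ p * max c₂ 1 * (2 * A) ^ (p * t) *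
      2 ^ (6 * p + (p * (p₀ + s) + 2 * p) + 1) ≤ ((2 * C * K * (s1 * 2 ^ s * Mc)) ^ p * max c₂ 1 * (2 * A) ^ (p * t) * 2 ^ (6 * p + (p * (p₀ + s) + 2 * p) + 1) * (240 : ℝ) ^ (p * p₀ + p * t + p * (s + 6))) := by
    have h240 : (1 : ℝ) ≤ (240 : ℝ) ^ (p * p₀ + p * t + p * (s + 6)) := one_le_pow₀ (by norm_num)
    have hX : 0 ≤ (2 * C * K * (s1 * 2 ^ s * Mc)) := by positivity
    have h0 : 0 ≤ (2 * C * K * (s1 * 2 ^ s * Mc)) ^ p * max c₂ 1 * (2 * A) ^ (p * t) *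
        2 ^ (6 * p + (p * (p₀ + s) + 2 * p) + 1) := by positivity
    exact le_mul_of_one_le_right h0 h240
  have hΘ0 : 0 ≤ ((2 * C * K * (s1 * 2 ^ s * Mc)) ^ p * max c₂ 1 * (2 * A) ^ (p * t) * 2 ^ (6 * p + (p * (p₀ + s) + 2 * p) + 1) * (240 : ℝ) ^ (p * p₀ + p * t + p * (s + 6))) := by positivity
  have hX0 : 0 ≤ (2 * C * K * (s1 * 2 ^ s * Mc)) := by positivity
  -- the weight factor `(2 max 1 (A₈/ℓ))^{pt} ≤ (2A₈)^{pt}`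
  have hD : (2 * max 1 (A / ℓ)) ^ (p * t) ≤ (2 * A) ^ (p * t) :=
    pow_le_pow_left₀ (by positivity) (by linarith) _
  have hsN0 : 0 ≤ schwartzNorm (p * t + 0 + (6 * p + (p * (p₀ + s) + 2 * p))) F := schwartzNorm_nonneg _ _
  calc (2 * C * ℓ ^ p₀ * (s1 * 2 ^ s * Mc * ℓ ^ s) * K) ^ p *
        (max c₂ 1 * (2 * max 1 (A / ℓ)) ^ (p * t) * 2 ^ ((6 * p + (p * (p₀ + s) + 2 * p)) + 1) * 1 *
          ((1 + max ‖bp‖ (7 * ℓ)) ^ (6 * p + (p * (p₀ + s) + 2 * p)))⁻¹ *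
          schwartzNorm (p * t + 0 + (6 * p + (p * (p₀ + s) + 2 * p))) F)
      ≤ (2 * C * ℓ ^ p₀ * (s1 * 2 ^ s * Mc * ℓ ^ s) * K) ^ p *
        (max c₂ 1 * (2 * A) ^ (p * t) * 2 ^ ((6 * p + (p * (p₀ + s) + 2 * p)) + 1) * 1 *
          ((((1 + ‖bp‖) ^ 6)⁻¹) ^ p * (ℓ ^ (p * (p₀ + s) + 2 * p))⁻¹) *
          schwartzNorm (p * (2 * t + p₀ + s + 12)) F) := by gcongr
    _ = ((2 * C * ℓ ^ p₀ * (s1 * 2 ^ s * Mc * ℓ ^ s) * K) ^ p *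
          (max c₂ 1 * (2 * A) ^ (p * t) * 2 ^ ((6 * p + (p * (p₀ + s) + 2 * p)) + 1)) *
          (ℓ ^ (p * (p₀ + s) + 2 * p))⁻¹) *
          (((1 + ‖bp‖) ^ 6)⁻¹) ^ p * schwartzNorm (p * (2 * t + p₀ + s + 12)) F := by ring
    _ = ((2 * C * K * (s1 * 2 ^ s * Mc)) ^ p * max c₂ 1 * (2 * A) ^ (p * t) * 2 ^ (6 * p + (p * (p₀ + s) + 2 * p) + 1)) *
          (ℓ ^ (2 * p))⁻¹ * (((1 + ‖bp‖) ^ 6)⁻¹) ^ p * schwartzNorm (p * (2 * t + p₀ + s + 12)) F := by rw [key, hℓpow]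
    _ ≤ ((2 * C * K * (s1 * 2 ^ s * Mc)) ^ p * max c₂ 1 * (2 * A) ^ (p * t) * 2 ^ (6 * p + (p * (p₀ + s) + 2 * p) + 1) * (240 : ℝ) ^ (p * p₀ + p * t + p * (s + 6))) * ℓ⁻¹ * (((1 + ‖bp‖) ^ 6)⁻¹) ^ p * schwartzNorm (p * (2 * t + p₀ + s + 12)) F :=
        mul_le_mul_of_nonneg_right (mul_le_mul_of_nonneg_right
          (mul_le_mul hconst hℓle (by positivity) hΘ0) (by positivity)) hsN

end Piece

end Summit.QuantumFields.YangMills.Theorems.ContinuumLegGivenGap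

end
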